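import Literature.AlgebraicGeometry.HodgeTheory.LefschetzOneOneEmbeddingCurrency
import Literature.AlgebraicGeometry.HodgeTheory.AbelianVarietyUniformisationPicardConverse
import Literature.Geometry.Kaehler.ComplexTorusLineBundleFactor
import HarnessLib

/-!
# The hyperplane class of an algebraised theta map: `[𝒪_X(D_Ψ)^an] = ⟦e⟧` in `Pic(X) = H¹(Λ, H⁰(𝒪_V^*))`

Generic leaf (consumer: cell hodgecm-mathlib, (U)-lane node U-aΘ, leaf L4 «a positive class has a power which is the
class of an AMPLE divisor» — the Pic-level identification of the hyperplane divisor of the algebraised theta embedding).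

Setting: a complex torus `X^an = E/Φ(ℤ^ι)` analytifying an integral complex scheme `X` (`φ : ComplexTorus Φ → X(ℂ)`),
a morphism `Ψ : X ⟶ ℙᴷ_ℂ`, and a factor of automorphy `e` with functions `θ_c` (theta functions for `e`) such that,
on the chart domains `φ⁻¹(Ψ⁻¹D₊(x_d)(ℂ))`, the affine coordinates of `Ψ` read on the universal cover are the ratios
`Ψ^*(x_c/x_d)(φ(π v)) = θ_c(v)/θ_d(v)`, the chart domain of `x_c` being `{θ_c ≠ 0}` («`Ψ^an ∘ π = [θ_0 : ⋯ : θ_K]`» in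
the currency of `Motives.AnalytificationKaehler.coordFun`/`chartDom`).  THEN the holomorphic line bundle
`𝒪_X(D_Ψ)^an` of the hyperplane divisor `D_Ψ = (Ψ^*x_{k₀})` has class `⟦e⟧` in Lange's `Pic(X)`:

  `picClass (cartierDivisorLineBundle hφ ((GeneratingSections.affineChartData Ψ).divisor k₀ hk₀)) = Factor.toPic ⟨e, he⟩`.

Proof: the cocycle `𝒪_X(D_Ψ)^an` is holomorphically isomorphic to the cocycle `W` on the chart domains with transition
functions the affine coordinates (★ `analyticallyEquivalent_cartierDivisorCocycle_divisor`, Hartshorne II 7.1), hence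
has the same `picClass` (★ `picClass_eq_iff_analyticallyEquivalent`); and `W` pulled back to `E` is framed by
`s_c := 1/θ_c` (a `ComplexTorus.IsCoverFrame`), whose factor `s_c(v)/s_c(v + λ) = θ_c(v + λ)/θ_c(v)` is `e` — so
`W ≅ L(e)` (★ `IsCoverFrame.isTrivialOn_tensor_factorLineBundle_inv`, Lange Prop. 1.2.2) and `picClass W = ⟦e⟧`
(★ `picClass_eq_toPic_iff`).  This is the Pic-level form of «`φ_L^*𝒪_{ℙᴺ}(1) ≅ L` for the map defined by a
base-point-free system of sections of `L`» ([GriffithsHarris1978] Ch. 1 §4; [Lange2023] §2.1.3).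
HC_CM is proved only modulo the 7 printed citations until rung 0 closes.

Edition 2 (module docstring only; declarations byte-identical to edition 1, p722200): first consumer in the tree =
`HodgeTheory/AmpleDivisorOfPositiveClass` (the U-aΘ L4 head, «a positive power of a positive class is the class of an
ample divisor», whose `hdom`/`hcoord` come from `HodgeTheory/ProjectiveSpaceCoordFunProjPoint`).

## References
* [Hartshorne1977] R. Hartshorne, *Algebraic Geometry* (GTM 52), II Thm. 7.1 (p. 150).
* [GriffithsHarris1978] P. Griffiths, J. Harris, *Principles of Algebraic Geometry*, Ch. 1 §1 pp. 144–145 and §4 pp. 176–180.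
* [Lange2023AbelianVarietiesComplex] H. Lange, *Abelian Varieties over the Complex Numbers* (2023), §1.2.1 Prop. 1.2.2–1.2.3 (p. 21), §2.1.3.
-/

noncomputable section

open scoped Manifold ContDiff Topology
open CategoryTheory AlgebraicGeometry TopologicalSpace Set Function

namespace Literature.AlgebraicGeometry.HodgeTheory

open Literature.AlgebraicGeometry.Motives Literature.AlgebraicGeometry.Motives.AlgPoints
  Literature.AlgebraicGeometry.Motives.AnalytificationKaehler
  Literature.NumberTheory.Transcendental Literature.Geometry.Kaehler Literature.Geometry.Kaehler.ComplexTorus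

section ThetaMap

variable {n K : ℕ} {X : SchemeOver ℂ} [IsIntegral X.left]
  {ι : Type} [Fintype ι] {E : Type} [NormedAddCommGroup E] [NormedSpace ℂ E] [FiniteDimensional ℂ E]
  {Φ : (ι → ℝ) ≃L[ℝ] E} {φ : ComplexTorus Φ → ComplexPoints X} (hφ : IsAnalytification E X n φ)
  (Ψ : X ⟶ projectiveSpace K ℂ)

/-- **`[𝒪_X(D_Ψ)^an] = [Ψ^*𝒪(1)^an]` in `Pic(X)`** for the hyperplane divisor `D_Ψ = (Ψ^*x_{k₀})` and ANY cocycle `L`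
on the chart domains `φ⁻¹(Ψ⁻¹D₊(x_a)(ℂ))` with transition functions the affine coordinates `g_ab = Ψ^*(x_a/x_b) ∘ φ`
(★ `exists_holomorphicLineBundle_coordChange_eq_coordFun` provides one) — ★ `analyticallyEquivalent_cartierDivisorCocycle_divisor`
read through ★ `picClass_eq_iff_analyticallyEquivalent`. [cite: Hartshorne1977, II Thm. 7.1]
[cite: Lange2023AbelianVarietiesComplex, §1.2.1 Prop. 1.2.2–1.2.3 (p. 21)] -/
theorem picClass_cartierDivisorLineBundle_divisor_eq_picClass_of_coordChange_eq_coordFun (k₀ : Fin (K + 1))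
    (hk₀ : genericPoint X.left ∈ (GeneratingSections.affineChartData Ψ).U k₀)
    (L : HolomorphicLineBundle (Fin (K + 1)) E (ComplexTorus Φ)) (hU : ∀ a, L.baseSet a = chartDom Ψ φ a)
    (hg : ∀ a b x, L.coordChange a b x = coordFun Ψ φ b x a) :
    picClass (cartierDivisorLineBundle hφ ((GeneratingSections.affineChartData Ψ).divisor k₀ hk₀)) = picClass L := by
  refine (picClass_eq_iff_analyticallyEquivalent _ _).2 ?_
  rw [cartierDivisorLineBundle_toSmoothCocycle]
  exact analyticallyEquivalent_cartierDivisorCocycle_divisor hφ Ψ k₀ hk₀ L.toSmoothCocycle id hU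
    (fun c d x _ ↦ hg d c x)

omit [IsIntegral X.left] in
/-- **THE HYPERPLANE CLASS OF AN ALGEBRAISED THETA MAP: `[Ψ^*𝒪(1)^an] = ⟦e⟧`.**  If on the universal cover the affine
coordinates of `Ψ` are the ratios of functions `θ_c` with the automorphy of the factor `e` (`θ_c(v + λ) = e(λ, v) θ_c(v)`),
the chart domain of `x_c` being `{θ_c ≠ 0}`, then `Ψ^*𝒪(1)^an ≅ L(e)`: the frame `s_c = 1/θ_c` of the pull-back to `E`
has factor `e` (Lange Prop. 1.2.2). [cite: Lange2023AbelianVarietiesComplex, §1.2.1 Prop. 1.2.2–1.2.3 (p. 21)]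
[cite: GriffithsHarris1978, Ch. 1 §4 pp. 176–180] -/
theorem picClass_eq_toPic_of_coordChange_eq_coordFun (L : HolomorphicLineBundle (Fin (K + 1)) E (ComplexTorus Φ))
    (hU : ∀ a, L.baseSet a = chartDom Ψ φ a) (hg : ∀ a b x, L.coordChange a b x = coordFun Ψ φ b x a)
    {e : (ι → ℤ) → E → ℂ} (he : IsFactor Φ e)
    (θ : Fin (K + 1) → E → ℂ) (hθd : ∀ c, Differentiable ℂ (θ c))
    (hθe : ∀ c (l : ι → ℤ) v, θ c (v + latticeVec Φ l) = e l v * θ c v)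
    (hdom : ∀ c v, cover Φ v ∈ chartDom Ψ φ c ↔ θ c v ≠ 0)
    (hcoord : ∀ c d v, cover Φ v ∈ chartDom Ψ φ d → coordFun Ψ φ d (cover Φ v) c = θ c v / θ d v) :
    picClass L = Factor.toPic ⟨e, he⟩ := by
  have hdom' : ∀ c v, cover Φ v ∈ L.baseSet c ↔ θ c v ≠ 0 := fun c v ↦ by rw [hU]; exact hdom c v
  -- the frame `s_c := 1/θ_c` of `π^* L`
  have hs : IsCoverFrame L (fun c v ↦ (θ c v)⁻¹) := by
    refine ⟨fun c ↦ ?_, fun c w hw ↦ inv_ne_zero ((hdom' c w).1 hw), fun c d w hc hd ↦ ?_⟩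
    · have hset : cover Φ ⁻¹' L.baseSet c = {v | θ c v ≠ 0} := by
        ext v
        exact hdom' c v
      rw [hset]
      exact ((hθd c).differentiableOn).inv fun v hv ↦ hv
    · have hc' : θ c w ≠ 0 := (hdom' c w).1 hc
      have hd' : θ d w ≠ 0 := (hdom' d w).1 hd
      have hdD : cover Φ w ∈ chartDom Ψ φ d := by rw [← hU]; exact hd
      rw [hg, hcoord c d w hdD]
      field_simp
  -- its factor is `e`
  have hfac : factorOfFrame L (fun c v ↦ (θ c v)⁻¹) = e := by
    funext l v
    obtain ⟨c, hc⟩ := L.exists_mem_baseSet (cover Φ v)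
    have hc' : θ c v ≠ 0 := (hdom' c v).1 hc
    rw [hs.factorOfFrame_eq hc, hθe c l v]
    field_simp
  have hF : (⟨factorOfFrame L (fun c v ↦ (θ c v)⁻¹), hs.isFactor⟩ : Factor Φ) = ⟨e, he⟩ := by
    ext l v
    exact congrFun (congrFun hfac l) v
  rw [← hF]
  exact (picClass_eq_toPic_iff L _).2 hs.isTrivialOn_tensor_factorLineBundle_inv

/-- **`[𝒪_X(D_Ψ)^an] = ⟦e⟧`**: the hyperplane divisor of an algebraised theta map has class `⟦e⟧` in `Pic(X)` (the two
previous theorems). [cite: Lange2023AbelianVarietiesComplex, §1.2.1 Prop. 1.2.2–1.2.3 (p. 21) and §2.1.3]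
[cite: Hartshorne1977, II Thm. 7.1] -/
theorem picClass_cartierDivisorLineBundle_divisor_eq_toPic (k₀ : Fin (K + 1))
    (hk₀ : genericPoint X.left ∈ (GeneratingSections.affineChartData Ψ).U k₀)
    {e : (ι → ℤ) → E → ℂ} (he : IsFactor Φ e)
    (θ : Fin (K + 1) → E → ℂ) (hθd : ∀ c, Differentiable ℂ (θ c))
    (hθe : ∀ c (l : ι → ℤ) v, θ c (v + latticeVec Φ l) = e l v * θ c v)
    (hdom : ∀ c v, cover Φ v ∈ chartDom Ψ φ c ↔ θ c v ≠ 0)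
    (hcoord : ∀ c d v, cover Φ v ∈ chartDom Ψ φ d → coordFun Ψ φ d (cover Φ v) c = θ c v / θ d v) :
    picClass (cartierDivisorLineBundle hφ ((GeneratingSections.affineChartData Ψ).divisor k₀ hk₀)) =
      Factor.toPic ⟨e, he⟩ := by
  obtain ⟨L, hU, hg⟩ := exists_holomorphicLineBundle_coordChange_eq_coordFun hφ Ψ
  rw [picClass_cartierDivisorLineBundle_divisor_eq_picClass_of_coordChange_eq_coordFun hφ Ψ k₀ hk₀ L hU hg]
  exact picClass_eq_toPic_of_coordChange_eq_coordFun Ψ L hU hg he θ hθd hθe hdom hcoord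

end ThetaMap

end Literature.AlgebraicGeometry.HodgeTheory

end
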